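import Literature.Barriers.HodgeConjecture.ConjugateVarietiesSerreProofs
import Literature.Barriers.HodgeConjecture.ConjugateVarietiesProofs
import Mathlib.NumberTheory.GaussSum
import Mathlib.NumberTheory.LegendreSymbol.QuadraticChar.Basic
import Mathlib.NumberTheory.LegendreSymbol.AddCharacter
import Mathlib.NumberTheory.LegendreSymbol.ZModChar
import Mathlib.NumberTheory.NumberField.Units.Basic
import Mathlib.NumberTheory.NumberField.Norm
import Mathlib.NumberTheory.NumberField.Cyclotomic.Basic
import Mathlib.Algebra.Polynomial.SpecificDegree
import Mathlib.Tactic.NormNum.IsSquare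
import Mathlib.Tactic.ComputeDegree
import Mathlib.Tactic.NormNum.Prime
import HarnessLib

/-!
# Serre 1964, no. 1 for `p = 23`: the arithmetic of `D = 𝓞 ℚ(√-23) ⊂ S = ℤ[ζ₂₃]`, proved

Companion to `ConjugateVarieties.lean` (the barrier fact
`Serre1964_conjugateVarieties_notHomeomorphic`), `ConjugateVarietiesProofs.lean` (reduction of
that fact to Serre's printed number-field / fundamental-group statement) and
`ConjugateVarietiesSerreProofs.lean` (the algebra of Serre's Théorème and Lemme 2 in abstract
form, and the `S`-side hypotheses for `S = ℤ[ζ_p]`).  Proofs only: no definitions, no named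
facts.

Source: J.-P. Serre, *Exemples de variétés projectives conjuguées non homéomorphes*, C. R. Acad.
Sci. Paris 258 (1964) 4194–4196 = *Œuvres* II, no. 63 (read 2026-08-15 in the held scan,
galaxy `panama:517577918906432`, pp. 246–248).  No. 1 fixes the data: `k = ℚ(√-p)`,
`p ≡ -1 (mod 4)`, `D = 𝒪_k`, class number `h` odd with `h > 1` and `(h, p - 1) = 1` —
"prenons par exemple `p = 23`, auquel cas `h = 3`" — and `S = ℤ[ζ_p] ⊃ D`; Lemme 2 then says
that `π₁(A_φ) ≅ S` is free while `π₁(A_ψ) ≅ e_ψ ⊗_D S` is not, because the class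
`e_ψ^{(p-1)/2}` is `≠ 1`.  This file supplies that `R`-side ("`D`-side") input for `p = 23`,
which the abstract Théorème of `ConjugateVarietiesSerreProofs.lean` left as hypotheses
(`𝔟 ⊂ R` non-principal, `[S : R]` and the non-principality of `𝔟^[S:R]`):

* `exists_sq_eq_neg_prime`, `exists_sq_eq_self_sub_six` — `√-p ∈ ℚ(ζ_p)` for `p ≡ 3 (mod 4)`
  (quadratic Gauss sum, Mathlib `gaussSum_sq`), so `ω = (1 + √-23)/2 ∈ K ⊇ ℚ(ζ₂₃)`,
  `ω² = ω - 6`: the inclusion `D ⊂ S`.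
* `minpoly_eq`, `finrank_adjoin_eq_two`, `exists_basis`, `trace_norm_coords` — `k = ℚ(ω)` has
  degree `2`, basis `{1, ω}`, `Tr(a + cω) = 2a + c`, `N(a + cω) = a² + ac + 6c²`.
* `span_pair_ne_top`, `not_isPrincipal_span_pair`, `span_pair_pow_three`,
  `not_isPrincipal_span_pair_pow_eleven` — in `D = 𝓞 ℚ(ω)` the ideal `𝔭 = (2, ω)` is proper,
  NOT principal (a generator would have norm dividing `(N 2, N ω) = (4, 6)`, i.e. `±1` or `±2`;
  `±1` forces `(1 - ω)/2 ∈ D`, of trace `1/2`; `±2` forces `t² + 23c² = 8` with `t ∈ ℤ`,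
  `c ∈ ℚ`, impossible), `𝔭³ = (ω - 2)`, hence `𝔭¹¹` is not principal.  DESIGN NOTE: Serre
  uses `h = 3` and `(h, p - 1) = 1`; Mathlib cannot at present compute `h(ℚ(√-23)) = 3`
  (no Minkowski-bound evaluation for a specific field), so we prove directly the one
  consequence the proof uses — `e^{11} ≠ 1` for the class `e = [𝔭]` — from `e ≠ 1`, `e³ = 1`.
  Nothing about `D` beyond `ω ∈ D` and the integrality of traces and norms is needed (in
  particular not `D = ℤ[ω]`).
* `finrank_adjoin_cyclotomic` — `[K : ℚ(ω)] = 22/2 = 11` (the rank of `S` over `D`, Lemme 1);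
  between the fraction fields of `𝓞 ℚ(ω) ⊂ 𝓞 K` (the exponent in `Ideal.relNorm_algebraMap`)
  this is transported by `finrank_fractionRing_ringOfIntegers` of the sibling file.
* `isEmpty_mulEquiv_twentyThree` — **Serre's Théorème for `p = 23` with all ring data
  explicit**: groups `Γ ⊇ N ≅ (𝓞 K, +)`, `Γ' ⊇ N' ≅ (𝔭·𝓞 K, +)` (normal, index `23`, an
  element acting as multiplication by `ζ₂₃`) are not isomorphic.  Only the identification of
  `π₁(V_φ(ℂ))`, `π₁(V_ψ(ℂ))` with such `Γ`, `Γ'` — the GEOMETRIC half of Serre's note (CM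
  uniformisation, Lemme 1, the free quotient `V = (Y × E¹¹)/(ℤ/23)`, Lefschetz, `π₁` of the
  isotrivial fibration) — remains hypothetical, and
* `serre1964_of_fundamentalGroup_models` records exactly that: given Serre's `V/H`, `φ`, `ψ` with
  fundamental groups of this shape, `Serre1964_conjugateVarieties_notHomeomorphic` holds (via
  `serre1964_of_numberField_fundamentalGroup_form`).
* `exists_powerBasis_ringOfIntegers_cyclotomic`, `lemmeOne_twentyThree` — **Lemme 1**: `S = ℤ[ζ_p]`
  is a free `D`-module, indeed `1, ζ, …, ζ^{[K:k]-1}` is a `𝓞 k`-basis of `𝓞 K` for every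
  subfield `k` (relative monogenicity, `exists_powerBasis_ringOfIntegers_of_adjoin_eq_top`); for
  `p = 23`, rank `11` and the embedding `S ↪ M₁₁(D)` by which `S` acts on `A = E¹¹` in no. 2.
* `exists_addEquiv_pi_ideal_map`, `isEmpty_mulEquiv_twentyThree_pi` — the module part of
  **Lemme 2**, "`π₁(A_φ) = π₁(E_φ) ⊗_D S`": in a `D`-basis `b` of `S`, `𝔞^{11} ≅ 𝔞S` with `S` acting
  on the left through its regular representation `ρ_b : S ↪ M₁₁(D)`; whence the Théorème for
  `p = 23` with `N' ≅ 𝔭¹¹ = π₁(E_ψ)¹¹` and `G` acting through `ρ_b(ζ₂₃)`, the form in which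
  Serre's no. 2 (`G` acting on `A = E¹¹` via `S ↪ M₁₁(D) = M₁₁(End E)`) delivers it;
  `isEmpty_mulEquiv_twentyThree_lattice` — the same with also `N ≅ D¹¹` in coordinates.

## References

* [Serre1964Conjugate] J.-P. Serre, C. R. Acad. Sci. Paris 258 (1964) 4194–4196 (= *Œuvres* II,
  no. 63), no. 1 ("`p = 23`, `h = 3`"), Lemmes 1–2, Théorème p. 4196.
* [Charles2009Conjugate] F. Charles, J. reine angew. Math. 636 (2009) 1–46, §1 (Serre's example
  recalled).
-/

namespace Literature.Barriers.HodgeConjecture.Serre1964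

open NumberField Polynomial IntermediateField

/-! ### `√-p ∈ ℚ(ζ_p)` for `p ≡ 3 (mod 4)` (Gauss sum) -/

section GaussSum

/-- **`ℚ(√-p) ⊂ ℚ(ζ_p)` for `p ≡ 3 (mod 4)`**: if a field of characteristic `0` contains a
primitive `p`-th root of unity `ζ` (`p` prime, `p ≡ 3 mod 4`), it contains a square root of `-p`,
namely the quadratic Gauss sum `g = ∑ (a/p) ζ^a`, `g² = (-1/p)·p = -p` (Mathlib `gaussSum_sq`).
This is the inclusion `k = ℚ(√-p) ⊂ ℚ(ζ_p)`, i.e. `D ⊂ S`, of Serre 1964, no. 1. [folklore]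
[cite: Serre1964Conjugate, no. 1] -/
theorem exists_sq_eq_neg_prime {p : ℕ} [hp : Fact p.Prime] (hp3 : p % 4 = 3) {K : Type*}
    [Field K] [CharZero K] {ζ : K} (hζ : IsPrimitiveRoot ζ p) : ∃ δ : K, δ ^ 2 = -(p : K) := by
  classical
  haveI : NeZero p := ⟨hp.out.ne_zero⟩
  have hchar : ringChar (ZMod p) ≠ 2 := by
    rw [ZMod.ringChar_zmod_n]
    omega
  let χ : MulChar (ZMod p) K := (quadraticChar (ZMod p)).ringHomComp (Int.castRingHom K)
  let ψ : AddChar (ZMod p) K := AddChar.zmodChar p hζ.pow_eq_one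
  have hχ1 : χ ≠ 1 :=
    (MulChar.ringHomComp_ne_one_iff (RingHom.injective_int (Int.castRingHom K))).2
      (quadraticChar_ne_one hchar)
  have hχ2 : χ.IsQuadratic := (quadraticChar_isQuadratic (ZMod p)).comp _
  have hψ : ψ.IsPrimitive := AddChar.zmodChar_primitive_of_primitive_root p hζ
  refine ⟨gaussSum χ ψ, ?_⟩
  rw [gaussSum_sq hχ1 hχ2 hψ, ZMod.card]
  have hneg : χ (-1) = -1 := by
    simp only [χ, MulChar.ringHomComp_apply, quadraticChar_neg_one hchar, ZMod.card,
      ZMod.χ₄_nat_three_mod_four hp3, Int.reduceNeg, eq_intCast, Int.cast_neg, Int.cast_one]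
  rw [hneg, neg_one_mul]

/-- **`ω = (1 + √-23)/2 ∈ ℚ(ζ₂₃)`**: a field of characteristic `0` with a primitive 23rd root
of unity contains a root of `X² - X + 6`, the minimal polynomial of `(1 + √-23)/2`
(so `ℤ[ω] = 𝓞 ℚ(√-23) = D ⊂ S = ℤ[ζ₂₃]` in Serre 1964, no. 1 with `p = 23`). [folklore]
[cite: Serre1964Conjugate, no. 1] -/
theorem exists_sq_eq_self_sub_six {K : Type*} [Field K] [CharZero K] {ζ : K}
    (hζ : IsPrimitiveRoot ζ 23) : ∃ ω : K, ω ^ 2 = ω - 6 := by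
  haveI : Fact (Nat.Prime 23) := ⟨by norm_num⟩
  obtain ⟨δ, hδ⟩ := exists_sq_eq_neg_prime (p := 23) (by norm_num) hζ
  refine ⟨(1 + δ) / 2, ?_⟩
  have h2 : (2 : K) ≠ 0 := two_ne_zero
  field_simp
  push_cast at hδ
  linear_combination hδ

end GaussSum

/-! ### The quadratic field `k = ℚ(ω)`, `ω² = ω - 6`: basis, trace and norm -/

section Quadratic

variable {L : Type*} [Field L] [CharZero L] {ω : L}

/-- `X² - X + 6` is irreducible over `ℚ` (it has no rational root: `x² - x + 6 > 0`). [folklore] -/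
theorem irreducible_X_sq_sub_X_add_six : Irreducible (X ^ 2 - X + C 6 : ℚ[X]) := by
  refine irreducible_of_degree_le_three_of_not_isRoot ?_ fun x hx ↦ ?_
  · have : (X ^ 2 - X + C 6 : ℚ[X]).natDegree = 2 := by compute_degree!
    rw [this]
    decide
  · have h : x ^ 2 - x + 6 = 0 := by simpa using hx
    nlinarith [sq_nonneg (x - 1 / 2)]

/-- `ω` with `ω² = ω - 6` is integral over `ℚ` with minimal polynomial `X² - X + 6`. [folklore] -/
theorem minpoly_eq (hω : ω ^ 2 = ω - 6) : minpoly ℚ ω = X ^ 2 - X + C 6 := by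
  refine (minpoly.eq_of_irreducible_of_monic irreducible_X_sq_sub_X_add_six ?_ (by monicity!)).symm
  simp only [map_add, map_sub, map_pow, aeval_X, aeval_C, eq_ratCast, Rat.cast_ofNat]
  linear_combination hω

/-- `ω` is integral (algebraic) over `ℚ`. [folklore] -/
theorem isIntegral_rat (hω : ω ^ 2 = ω - 6) : IsIntegral ℚ ω :=
  ⟨X ^ 2 - X + C 6, by monicity!, by
    simp only [eval₂_add, eval₂_sub, eval₂_X_pow, eval₂_X, eval₂_C, eq_ratCast, Rat.cast_ofNat]
    linear_combination hω⟩

/-- `[ℚ(ω) : ℚ] = 2`. [folklore] -/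
theorem finrank_adjoin_eq_two (hω : ω ^ 2 = ω - 6) : Module.finrank ℚ ℚ⟮ω⟯ = 2 := by
  rw [adjoin.finrank (isIntegral_rat hω), minpoly_eq hω]
  compute_degree!

/-- **A `ℚ`-basis `{1, ω}` of `ℚ(ω)`** (the power basis of the generator, reindexed by
`Fin 2`). [folklore] -/
theorem exists_basis (hω : ω ^ 2 = ω - 6) :
    ∃ b : Module.Basis (Fin 2) ℚ ℚ⟮ω⟯, b 0 = 1 ∧ b 1 = AdjoinSimple.gen ℚ ω := by
  let pb := adjoin.powerBasis (isIntegral_rat hω)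
  have hdim : pb.dim = 2 := by
    show (minpoly ℚ ω).natDegree = 2
    rw [minpoly_eq hω]; compute_degree!
  refine ⟨pb.basis.reindex (finCongr hdim), ?_, ?_⟩
  · rw [Module.Basis.reindex_apply, pb.basis_eq_pow]
    simp [pb]
  · rw [Module.Basis.reindex_apply, pb.basis_eq_pow]
    simp [pb]

variable {F : Type*} [CommRing F] [Algebra ℚ F]

/-- Coordinates: with a basis `{1, α}`, every element is `a + c α`. [folklore] -/
theorem exists_coords (b : Module.Basis (Fin 2) ℚ F) {α : F} (hb0 : b 0 = 1) (hb1 : b 1 = α)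
    (x : F) : ∃ a c : ℚ, x = algebraMap ℚ F a + algebraMap ℚ F c * α := by
  refine ⟨b.repr x 0, b.repr x 1, ?_⟩
  conv_lhs => rw [← b.sum_repr x]
  rw [Fin.sum_univ_two, hb0, hb1, Algebra.algebraMap_eq_smul_one, ← Algebra.smul_def]

/-- The coordinate vector of `a + c α` in the basis `{1, α}`. [folklore] -/
theorem repr_coords (b : Module.Basis (Fin 2) ℚ F) {α : F} (hb0 : b 0 = 1) (hb1 : b 1 = α)
    (a c : ℚ) (i : Fin 2) :
    b.repr (algebraMap ℚ F a + algebraMap ℚ F c * α) i = ![a, c] i := by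
  have hx : algebraMap ℚ F a + algebraMap ℚ F c * α = a • b 0 + c • b 1 := by
    rw [hb0, hb1, Algebra.algebraMap_eq_smul_one, ← Algebra.smul_def]
  rw [hx, map_add, map_smul, map_smul, b.repr_self, b.repr_self]
  fin_cases i <;> simp

/-- **Trace and norm of `ℚ(ω)/ℚ` in coordinates**: for `α² = α - 6` and a `ℚ`-basis `{1, α}`,
`Tr(a + cα) = 2a + c` and `N(a + cα) = a² + ac + 6c²` (the matrix of multiplication by
`a + cα` is `(a, -6c; c, a + c)`). [folklore] -/
theorem trace_norm_coords (b : Module.Basis (Fin 2) ℚ F) {α : F} (hb0 : b 0 = 1) (hb1 : b 1 = α)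
    (hα : α ^ 2 = α - 6) (a c : ℚ) :
    Algebra.trace ℚ F (algebraMap ℚ F a + algebraMap ℚ F c * α) = 2 * a + c ∧
      Algebra.norm ℚ (algebraMap ℚ F a + algebraMap ℚ F c * α) = a ^ 2 + a * c + 6 * c ^ 2 := by
  classical
  set x := algebraMap ℚ F a + algebraMap ℚ F c * α with hx
  have hx0 : x * b 0 = algebraMap ℚ F a + algebraMap ℚ F c * α := by rw [hb0, mul_one]
  have hx1 : x * b 1 = algebraMap ℚ F (-6 * c) + algebraMap ℚ F (a + c) * α := by
    rw [hb1, hx, map_mul, map_add, map_neg]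
    have h6 : (algebraMap ℚ F 6) = 6 := map_ofNat _ 6
    rw [h6]
    linear_combination (algebraMap ℚ F c) * hα
  have hM : Algebra.leftMulMatrix b x = !![a, -6 * c; c, a + c] := by
    ext i j
    rw [Algebra.leftMulMatrix_eq_repr_mul]
    fin_cases j
    · simp only [Fin.zero_eta, Fin.isValue]
      rw [hx0, repr_coords b hb0 hb1]
      fin_cases i <;> simp
    · simp only [Fin.mk_one, Fin.isValue]
      rw [hx1, repr_coords b hb0 hb1]
      fin_cases i <;> simp
  constructor
  · rw [Algebra.trace_eq_matrix_trace b, hM, Matrix.trace_fin_two_of]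
    ring
  · rw [Algebra.norm_eq_matrix_det b, hM, Matrix.det_fin_two_of]
    ring

end Quadratic

/-! ### The ring of integers `𝓞 ℚ(ω)`: the ideal `𝔭 = (2, ω)` -/

section Integers

variable {L : Type*} [Field L] [NumberField L] {ω : L}

/-- `ω ∈ 𝓞 ℚ(ω)` (it is a root of the monic `X² - X + 6`). [folklore] -/
theorem exists_ringOfIntegers_coe_eq_gen (hω : ω ^ 2 = ω - 6) :
    ∃ w : 𝓞 ℚ⟮ω⟯, (w : ℚ⟮ω⟯) = AdjoinSimple.gen ℚ ω :=
  ⟨⟨AdjoinSimple.gen ℚ ω, ⟨X ^ 2 - X + C 6, by monicity!, by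
    rw [eval₂_add, eval₂_sub, eval₂_X_pow, eval₂_X, eval₂_C, map_ofNat]
    linear_combination
      (SetLike.coe_eq_coe.mp hω : AdjoinSimple.gen ℚ ω ^ 2 = AdjoinSimple.gen ℚ ω - 6)⟩⟩, rfl⟩

variable (hω : ω ^ 2 = ω - 6) (w : 𝓞 ℚ⟮ω⟯) (hw : (w : ℚ⟮ω⟯) = AdjoinSimple.gen ℚ ω)
include hω hw

/-- `ω² = ω - 6` in `𝓞 ℚ(ω)`. [folklore] -/
theorem ringOfIntegers_sq : w ^ 2 = w - 6 := by
  apply RingOfIntegers.ext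
  simp only [map_pow, map_sub, map_ofNat]
  rw [← RingOfIntegers.coe_eq_algebraMap, hw]
  exact SetLike.coe_eq_coe.mp hω

/-- `Tr(c) ∈ ℤ`, `Tr(1) = 2`, `Tr(ω) = 1` and the consequence used twice below: no algebraic
integer `c` of `ℚ(ω)` satisfies `2c = 1 - ω` (its trace would be `1/2`), i.e.
`(1 - ω)/2 ∉ 𝓞 ℚ(ω)`. [folklore] -/
theorem two_mul_ne_one_sub (c : 𝓞 ℚ⟮ω⟯) : 2 * c ≠ 1 - w := by
  obtain ⟨b, hb0, hb1⟩ := exists_basis hω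
  intro hc
  have hc' : (2 : ℚ) • (c : ℚ⟮ω⟯) = 1 - AdjoinSimple.gen ℚ ω := by
    have := congrArg (algebraMap (𝓞 ℚ⟮ω⟯) ℚ⟮ω⟯) hc
    rw [map_mul, map_sub, map_one, map_ofNat] at this
    rw [Algebra.smul_def, map_ofNat, RingOfIntegers.coe_eq_algebraMap, this,
      ← RingOfIntegers.coe_eq_algebraMap, hw]
  have htr := congrArg (Algebra.trace ℚ ℚ⟮ω⟯) hc'
  rw [map_smul, map_sub, smul_eq_mul] at htr
  have h1 : Algebra.trace ℚ ℚ⟮ω⟯ 1 = 2 := by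
    have := (trace_norm_coords b hb0 hb1 (SetLike.coe_eq_coe.mp hω) 1 0).1
    simp only [map_one, map_zero, zero_mul, add_zero, mul_one] at this
    exact this
  have hg : Algebra.trace ℚ ℚ⟮ω⟯ (AdjoinSimple.gen ℚ ω) = 1 := by
    have := (trace_norm_coords b hb0 hb1 (SetLike.coe_eq_coe.mp hω) 0 1).1
    simp only [map_zero, map_one, one_mul, zero_add, mul_zero] at this
    exact this
  rw [h1, hg, ← Algebra.coe_trace_int] at htr
  have h2 : (2 : ℤ) * Algebra.trace ℤ (𝓞 ℚ⟮ω⟯) c = 1 := by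
    have : ((2 : ℤ) * Algebra.trace ℤ (𝓞 ℚ⟮ω⟯) c : ℚ) = 1 := by
      push_cast; linarith
    exact_mod_cast this
  omega

/-- **`𝔭 = (2, ω) ≠ (1)`**: if `1 = 2a + ωd` then, multiplying by `1 - ω` (`ω(1 - ω) = 6`),
`1 - ω = 2(a(1 - ω) + 3d)`, contradicting `two_mul_ne_one_sub`. [folklore] -/
theorem span_pair_ne_top : Ideal.span {(2 : 𝓞 ℚ⟮ω⟯), w} ≠ ⊤ := by
  intro htop
  have h1 : (1 : 𝓞 ℚ⟮ω⟯) ∈ Ideal.span {(2 : 𝓞 ℚ⟮ω⟯), w} := htop ▸ Submodule.mem_top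
  obtain ⟨a, d, had⟩ := Ideal.mem_span_pair.1 h1
  have hw2 := ringOfIntegers_sq hω w hw
  refine two_mul_ne_one_sub hω w hw (a * (1 - w) + 3 * d) ?_
  linear_combination (1 - w) * had + d * hw2

omit hω hw in
/-- The ideal `𝔭 = (2, ω)` is nonzero. [folklore] -/
theorem span_pair_ne_bot : Ideal.span {(2 : 𝓞 ℚ⟮ω⟯), w} ≠ ⊥ := by
  intro h
  rw [Ideal.span_eq_bot] at h
  have : (2 : 𝓞 ℚ⟮ω⟯) = 0 := h 2 (by simp)
  exact two_ne_zero this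

/-- `N(2) = 4` and `N(ω) = 6` in `𝓞 ℚ(ω)`. [folklore] -/
theorem norm_two_and_norm_gen :
    Algebra.norm ℤ (2 : 𝓞 ℚ⟮ω⟯) = 4 ∧ Algebra.norm ℤ w = 6 := by
  obtain ⟨b, hb0, hb1⟩ := exists_basis hω
  constructor
  · have h := (trace_norm_coords b hb0 hb1 (SetLike.coe_eq_coe.mp hω) 2 0).2
    simp only [map_ofNat, map_zero, zero_mul, add_zero] at h
    have : (Algebra.norm ℤ (2 : 𝓞 ℚ⟮ω⟯) : ℚ) = 4 := by
      rw [Algebra.coe_norm_int, RingOfIntegers.coe_eq_algebraMap, map_ofNat, h]; norm_num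
    exact_mod_cast this
  · have h := (trace_norm_coords b hb0 hb1 (SetLike.coe_eq_coe.mp hω) 0 1).2
    simp only [map_zero, map_one, one_mul, zero_add] at h
    have : (Algebra.norm ℤ w : ℚ) = 6 := by
      rw [Algebra.coe_norm_int, RingOfIntegers.coe_eq_algebraMap]
      rw [RingOfIntegers.coe_eq_algebraMap] at hw
      rw [hw, h]; norm_num
    exact_mod_cast this

/-- **`𝔭 = (2, ω)` is not principal** ("`e_ψ ≠ 1`": the class of `𝔭` is a non-trivial
element of `Cl(D)`, `D = 𝓞 ℚ(√-23)`, `h = 3` — Serre 1964, no. 1, "prenons par exemple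
`p = 23`, auquel cas `h = 3`"). Proof: a generator `α` would divide `2` and `ω`, so
`N(α) | (4, 6) = 2`; `N(α) = ±1` makes `𝔭 = (1)` (`span_pair_ne_top`); `N(α) = ±2` is
impossible since `4N(a + cω) = (2a + c)² + 23c²` and `t² + 23c² = 8` has no solution with
`t = Tr(α) ∈ ℤ`, `c ∈ ℚ`. [cite: Serre1964Conjugate, no. 1]
[cite: Charles2009Conjugate, §1] -/
theorem not_isPrincipal_span_pair : ¬ (Ideal.span {(2 : 𝓞 ℚ⟮ω⟯), w}).IsPrincipal := by
  obtain ⟨b, hb0, hb1⟩ := exists_basis hω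
  intro hP
  obtain ⟨α, hα⟩ := hP.principal
  change Ideal.span {(2 : 𝓞 ℚ⟮ω⟯), w} = Ideal.span {α} at hα
  have h2 : α ∣ 2 := Ideal.mem_span_singleton.1 (hα ▸ Ideal.subset_span (by simp))
  have hwd : α ∣ w := Ideal.mem_span_singleton.1 (hα ▸ Ideal.subset_span (by simp))
  obtain ⟨hN2, hNw⟩ := norm_two_and_norm_gen hω w hw
  have hd4 : Algebra.norm ℤ α ∣ 4 := hN2 ▸ map_dvd (Algebra.norm ℤ) h2
  have hd6 : Algebra.norm ℤ α ∣ 6 := hNw ▸ map_dvd (Algebra.norm ℤ) hwd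
  have hd2 : Algebra.norm ℤ α ∣ 2 := by
    have := dvd_sub hd6 hd4
    norm_num at this
    exact this
  have habs : (Algebra.norm ℤ α).natAbs ∣ 2 := Int.natAbs_dvd_natAbs.2 hd2
  rcases (Nat.dvd_prime Nat.prime_two).1 habs with h1 | h2'
  · -- `α` is a unit: `𝔭 = (1)`
    have hu : IsUnit α := by
      rw [NumberField.isUnit_iff_norm, RingOfIntegers.coe_norm, ← Algebra.coe_norm_int,
        ← Int.cast_abs, ← Int.natCast_natAbs, h1]
      norm_num
    exact span_pair_ne_top hω w hw (hα ▸ Ideal.span_singleton_eq_top.2 hu)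
  · -- `N(α) = ±2` is impossible
    obtain ⟨a, c, hac⟩ := exists_coords b hb0 hb1 (α : ℚ⟮ω⟯)
    obtain ⟨htr, hno⟩ := trace_norm_coords b hb0 hb1 (SetLike.coe_eq_coe.mp hω) a c
    rw [← hac] at htr hno
    rw [← Algebra.coe_trace_int] at htr
    rw [← Algebra.coe_norm_int] at hno
    set m := Algebra.trace ℤ (𝓞 ℚ⟮ω⟯) α with hm
    have hkey : (m : ℚ) ^ 2 + 23 * c ^ 2 = 4 * (Algebra.norm ℤ α : ℚ) := by
      rw [htr, hno]; ring
    rcases Int.natAbs_eq_iff.1 h2' with hn | hn <;> rw [hn] at hkey <;> push_cast at hkey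
    · have hm2 : m ^ 2 ≤ 8 := by
        have : (m : ℚ) ^ 2 ≤ 8 := by nlinarith [sq_nonneg c]
        exact_mod_cast this
      have hml : -2 ≤ m := by nlinarith
      have hmu : m ≤ 2 := by nlinarith
      have hsq : IsSquare ((23 * c) ^ 2) := ⟨23 * c, sq _⟩
      interval_cases m
      · rw [show (23 * c) ^ 2 = 92 by push_cast at hkey; linear_combination 23 * hkey] at hsq
        exact absurd hsq (by norm_num)
      · rw [show (23 * c) ^ 2 = 161 by push_cast at hkey; linear_combination 23 * hkey] at hsq
        exact absurd hsq (by norm_num)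
      · rw [show (23 * c) ^ 2 = 184 by push_cast at hkey; linear_combination 23 * hkey] at hsq
        exact absurd hsq (by norm_num)
      · rw [show (23 * c) ^ 2 = 161 by push_cast at hkey; linear_combination 23 * hkey] at hsq
        exact absurd hsq (by norm_num)
      · rw [show (23 * c) ^ 2 = 92 by push_cast at hkey; linear_combination 23 * hkey] at hsq
        exact absurd hsq (by norm_num)
    · nlinarith [sq_nonneg (m : ℚ), sq_nonneg c]

/-- **`𝔭³ = (ω - 2)`** in `𝓞 ℚ(ω)` (so the class of `𝔭` has order `3`: `h = 3`):
`(2, ω)² = (4, ω - 2)`, `(4, ω - 2)(2, ω) ⊆ (ω - 2)` as `8 = (ω - 2)(-ω - 1)` and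
`4ω = (ω - 2)(3 - ω)`; conversely `ω - 2 = 2·8 + 4ω + 2ω² + ω³`. [folklore]
[cite: Serre1964Conjugate, no. 1] -/
theorem span_pair_pow_three :
    (Ideal.span {(2 : 𝓞 ℚ⟮ω⟯), w}) ^ 3 = Ideal.span {w - 2} := by
  have hw2 := ringOfIntegers_sq hω w hw
  set 𝔟 := Ideal.span {(2 : 𝓞 ℚ⟮ω⟯), w} with h𝔟
  apply le_antisymm
  · have hsq : 𝔟 ^ 2 ≤ Ideal.span {(4 : 𝓞 ℚ⟮ω⟯), w - 2} := by
      rw [pow_two, Ideal.mul_le]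
      intro r hr s hs
      obtain ⟨a₁, d₁, rfl⟩ := Ideal.mem_span_pair.1 hr
      obtain ⟨a₂, d₂, rfl⟩ := Ideal.mem_span_pair.1 hs
      refine Ideal.mem_span_pair.2
        ⟨a₁ * a₂ + (a₁ * d₂ + a₂ * d₁) - d₁ * d₂, 2 * (a₁ * d₂ + a₂ * d₁) + d₁ * d₂, ?_⟩
      linear_combination (-(d₁ * d₂)) * hw2
    calc 𝔟 ^ 3 = 𝔟 ^ 2 * 𝔟 := pow_succ 𝔟 2
      _ ≤ Ideal.span {(4 : 𝓞 ℚ⟮ω⟯), w - 2} * 𝔟 := Ideal.mul_mono_left hsq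
      _ ≤ Ideal.span {w - 2} := by
        rw [Ideal.mul_le]
        intro r hr s hs
        obtain ⟨a₁, d₁, rfl⟩ := Ideal.mem_span_pair.1 hr
        obtain ⟨a₂, d₂, rfl⟩ := Ideal.mem_span_pair.1 hs
        refine Ideal.mem_span_singleton.2
          (Dvd.intro (a₁ * a₂ * (-w - 1) + a₁ * d₂ * (3 - w) + d₁ * (a₂ * 2 + d₂ * w)) ?_)
        linear_combination (-(a₁ * a₂ + a₁ * d₂)) * hw2
  · rw [Ideal.span_singleton_le_iff_mem]
    have h2 : (2 : 𝓞 ℚ⟮ω⟯) ∈ 𝔟 := Ideal.subset_span (by simp)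
    have hw' : w ∈ 𝔟 := Ideal.subset_span (by simp)
    have hmem : ∀ x y z, x ∈ 𝔟 → y ∈ 𝔟 → z ∈ 𝔟 → x * y * z ∈ 𝔟 ^ 3 := by
      intro x y z hx hy hz
      rw [pow_three, ← mul_assoc]  -- hmm `pow_three : a^3 = a * (a * a)`
      exact Ideal.mul_mem_mul (Ideal.mul_mem_mul hx hy) hz
    have : w - 2 = 2 * (2 * 2 * 2) + 2 * 2 * w + 2 * w * w + w * w * w := by
      linear_combination (-(w + 3)) * hw2
    rw [this]
    exact add_mem (add_mem (add_mem (Ideal.mul_mem_left _ 2 (hmem _ _ _ h2 h2 h2))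
      (hmem _ _ _ h2 h2 hw')) (hmem _ _ _ h2 hw' hw')) (hmem _ _ _ hw' hw' hw')

/-- **`𝔭¹¹` is not principal** — the input "`e_ψ^{(p-1)/2} ≠ 1` comme `e_ψ ≠ 1` et `h`
premier à `p - 1`" of Serre's Lemme 2 for `p = 23`, `(p - 1)/2 = 11`, obtained here without
computing the class number: if `𝔭¹¹ = (x)` then `(x)·𝔭 = 𝔭¹² = ((ω - 2)⁴)`, so
`(ω - 2)⁴ = zx` and cancelling `(x)` gives `𝔭 = (z)`, contradicting
`not_isPrincipal_span_pair`. [cite: Serre1964Conjugate, no. 1, Lemme 2 and its proof] -/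
theorem not_isPrincipal_span_pair_pow_eleven :
    ¬ ((Ideal.span {(2 : 𝓞 ℚ⟮ω⟯), w}) ^ 11).IsPrincipal := by
  set 𝔟 := Ideal.span {(2 : 𝓞 ℚ⟮ω⟯), w} with h𝔟
  intro hP
  obtain ⟨x, hx⟩ := hP.principal
  change 𝔟 ^ 11 = Ideal.span {x} at hx
  have h12 : 𝔟 ^ 12 = Ideal.span {(w - 2) ^ 4} := by
    rw [show 12 = 3 * 4 from rfl, pow_mul, span_pair_pow_three hω w hw, Ideal.span_singleton_pow]
  have h12' : 𝔟 ^ 12 = Ideal.span {x} * 𝔟 := by rw [pow_succ, hx]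
  have hx0 : x ≠ 0 := by
    rintro rfl
    have : 𝔟 ^ 11 = ⊥ := by rw [hx, Ideal.span_singleton_eq_bot]
    exact span_pair_ne_bot w (pow_eq_zero_iff (by norm_num) |>.1 this)
  have hy : (w - 2) ^ 4 ∈ Ideal.span {x} := by
    have : (w - 2) ^ 4 ∈ Ideal.span {x} * 𝔟 := by
      rw [← h12', h12]; exact Ideal.mem_span_singleton_self _
    exact Ideal.mul_le_right this
  obtain ⟨z, hz⟩ := Ideal.mem_span_singleton'.1 hy
  have heq : Ideal.span {x} * 𝔟 = Ideal.span {x} * Ideal.span {z} := by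
    rw [← h12', h12, Ideal.span_singleton_mul_span_singleton, mul_comm x z, hz]
  have h𝔟z : 𝔟 = Ideal.span {z} := (Ideal.span_singleton_mul_right_inj hx0).1 heq
  exact not_isPrincipal_span_pair hω w hw ⟨⟨z, h𝔟z⟩⟩

end Integers

/-! ### Degrees: `[ℚ(ζ₂₃) : ℚ(ω)] = 11`, also between the fraction fields of the integers -/

section Degree

/-- **`[ℚ(ζ₂₃) : ℚ(ω)] = 11 = (p - 1)/2`** (`[ℚ(ζ₂₃) : ℚ] = φ(23) = 22`, `[ℚ(ω) : ℚ] = 2`);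
this is the rank of `S = ℤ[ζ_p]` over `D`, Serre 1964, no. 1, Lemme 1. [cite: Serre1964Conjugate, no. 1, Lemme 1] -/
theorem finrank_adjoin_cyclotomic {K : Type*} [Field K] [NumberField K]
    [IsCyclotomicExtension {23} ℚ K] {ω : K} (hω : ω ^ 2 = ω - 6) :
    Module.finrank ℚ⟮ω⟯ K = 11 := by
  have h1 : Module.finrank ℚ K = 22 := by
    rw [IsCyclotomicExtension.Rat.finrank 23 K, Nat.totient_prime (by norm_num)]
  have h2 := Module.finrank_mul_finrank ℚ ℚ⟮ω⟯ K
  rw [finrank_adjoin_eq_two hω, h1] at h2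
  omega

end Degree

/-! ### Assembly: Serre's Théorème for `p = 23` with all ring data explicit -/

section Assembly

open Multiplicative

/-- **Serre 1964, Théorème, for `p = 23` — everything but the fundamental groups explicit.**
Let `K ⊇ ℚ(ζ₂₃)` be the 23rd cyclotomic field, `S = 𝓞 K = ℤ[ζ₂₃]`, `ω ∈ K` a root of
`X² - X + 6` (`ω = (1 ± √-23)/2`, `exists_sq_eq_self_sub_six`), `D = 𝓞 ℚ(ω)` and
`𝔭 = (2, ω) ⊂ D` (non-principal with `𝔭³` principal: the class `e_ψ ≠ 1` of Serre's no. 1 for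
`p = 23`, `h = 3`). If `Γ ⊇ N ≅ (S, +)` and `Γ' ⊇ N' ≅ (𝔭S, +)` are groups containing these as
normal subgroups of index `23` on which some element acts as multiplication by `ζ₂₃` — in Serre,
`Γ = π₁(V_φ) ⊇ π₁(A_φ) = π₁(E_φ) ⊗_D S ≅ S` and `Γ' = π₁(V_ψ) ⊇ π₁(A_ψ) ≅ e_ψ ⊗_D S = 𝔭S`
— then `Γ ≄ Γ'`: an isomorphism makes `𝔭S` principal (`isPrincipal_of_mulEquiv`, the
Théorème's semilinearity argument, with the `S`-side hypotheses of
`ringOfIntegers_cyclotomic_hypotheses`), hence `N_{S/D}(𝔭S) = 𝔭^[K:ℚ(ω)] = 𝔭¹¹` principal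
(`isPrincipal_pow_finrank_of_isPrincipal_map`, Lemme 2 in norm form), contradicting
`not_isPrincipal_span_pair_pow_eleven`.  No class-number computation is used: Serre's
"`h = 3`, `(h, p - 1) = 1`" enters only through `𝔭` non-principal and `𝔭³ = (ω - 2)`.
[cite: Serre1964Conjugate, no. 1 (p = 23, h = 3), Lemme 2, Théorème p. 4196] -/
theorem isEmpty_mulEquiv_twentyThree {K : Type*} [Field K] [NumberField K]
    [IsCyclotomicExtension {23} ℚ K] {ζ : K} (hζ : IsPrimitiveRoot ζ 23)
    {ω : K} (hω : ω ^ 2 = ω - 6) (w : 𝓞 ℚ⟮ω⟯) (hw : (w : ℚ⟮ω⟯) = AdjoinSimple.gen ℚ ω)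
    {Γ Γ' : Type*} [Group Γ] [Group Γ']
    (ι : Multiplicative (𝓞 K) →* Γ) (hι : Function.Injective ι) [ι.range.Normal]
    (hιi : ι.range.index = 23) (γ₀ : Γ)
    (hγ₀ : ∀ s : 𝓞 K, γ₀ * ι (ofAdd s) * γ₀⁻¹ = ι (ofAdd (hζ.toInteger * s)))
    (ι' : Multiplicative
      ↥((Ideal.span {(2 : 𝓞 ℚ⟮ω⟯), w}).map (algebraMap (𝓞 ℚ⟮ω⟯) (𝓞 K))) →* Γ')
    (hι' : Function.Injective ι') [ι'.range.Normal] (hι'i : ι'.range.index = 23) (γ₀' : Γ')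
    (hγ₀' : ∀ b : ↥((Ideal.span {(2 : 𝓞 ℚ⟮ω⟯), w}).map (algebraMap (𝓞 ℚ⟮ω⟯) (𝓞 K))),
      γ₀' * ι' (ofAdd b) * γ₀'⁻¹ = ι' (ofAdd (hζ.toInteger • b))) :
    IsEmpty (Γ ≃* Γ') := by
  haveI : Fact (Nat.Prime 23) := ⟨by norm_num⟩
  obtain ⟨hζ1, hgen, hτ⟩ := ringOfIntegers_cyclotomic_hypotheses hζ
  have hI0 : (Ideal.span {(2 : 𝓞 ℚ⟮ω⟯), w}).map (algebraMap (𝓞 ℚ⟮ω⟯) (𝓞 K)) ≠ ⊥ := fun h ↦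
    span_pair_ne_bot w ((Ideal.map_eq_bot_iff_of_injective
      (RingOfIntegers.algebraMap.injective ℚ⟮ω⟯ K)).1 h)
  refine ⟨fun f ↦ not_isPrincipal_span_pair_pow_eleven hω w hw ?_⟩
  have hP := isPrincipal_of_mulEquiv (Fact.out) hζ1 hgen hτ hI0 ι hι hιi γ₀ hγ₀ ι' hι' hι'i
    γ₀' hγ₀' f
  have hpow := isPrincipal_pow_finrank_of_isPrincipal_map hP
  rwa [finrank_fractionRing_ringOfIntegers, finrank_adjoin_cyclotomic hω] at hpow

end Assembly

/-! ### Back to the barrier fact: what the geometric half of Serre's proof must supply -/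

section Barrier

open Multiplicative Literature.AlgebraicGeometry.Motives

/-- **Serre 1964 ⇒ `Serre1964_conjugateVarieties_notHomeomorphic`, modulo the geometric half.**
With the arithmetic of no. 1 (`p = 23`: `S = ℤ[ζ₂₃]`, `D = 𝓞 ℚ(ω)`, `𝔭 = (2, ω)`) and the
algebra of the Théorème proved (`isEmpty_mulEquiv_twentyThree`), the vendored barrier fact
follows from the existence of Serre's variety: a smooth projective `V` over a number field `H`
(Serre: the Hilbert class field of `ℚ(√-23)`, `V = (Y × E¹¹)/(ℤ/23)`, no. 2) and embeddings
`φ, ψ : H → ℂ` such that `π₁(V_φ(ℂ), x) ⊇ N ≅ (S, +)` and `π₁(V_ψ(ℂ), y) ⊇ N' ≅ (𝔭S, +)` are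
normal subgroups of index `23` on which some element acts as multiplication by `ζ₂₃` (Serre:
`π₁(V_φ) = π₁(A_φ)·G` with `π₁(A_φ) = π₁(E_φ) ⊗_D S`, `π₁(E_φ) ≅ D` free and `π₁(E_ψ) ≅ e_ψ`
not free, no. 1–2) — then `π₁(V_φ(ℂ)) ≄ π₁(V_ψ(ℂ))` (Théorème), so `V_φ(ℂ)`, `V_ψ(ℂ)` are not
homeomorphic (p. 4194) and `serre1964_of_numberField_fundamentalGroup_form` concludes.  The two
hypotheses `hφ`, `hψ` are exactly the output of the GEOMETRIC half of Serre's note (CM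
uniformisation `E_φ(ℂ) ≅ ℂ/𝔞_φ`, Lemme 1, the free quotient `(Y × A)/G`, Lefschetz
`π₁(Y) = 1`, `π₁` of the isotrivial fibration with section), which is not in the tree.
[cite: Serre1964Conjugate, nos. 1–2 and Théorème p. 4196] -/
theorem serre1964_of_fundamentalGroup_models {K : Type*} [Field K] [NumberField K]
    [IsCyclotomicExtension {23} ℚ K] {ζ : K} (hζ : IsPrimitiveRoot ζ 23)
    {ω : K} (hω : ω ^ 2 = ω - 6) (w : 𝓞 ℚ⟮ω⟯) (hw : (w : ℚ⟮ω⟯) = AdjoinSimple.gen ℚ ω)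
    {H : Type} [Field H] [NumberField H] {n : ℕ} {V : SchemeOver H}
    (hV : IsSmoothProjective n V) (φ ψ : H →+* ℂ)
    [Nonempty (ComplexPoints ((baseChangeHom φ).obj V))]
    (hφ : ∀ x : ComplexPoints ((baseChangeHom φ).obj V),
      ∃ (ι : Multiplicative (𝓞 K) →* FundamentalGroup _ x) (γ₀ : FundamentalGroup _ x),
        Function.Injective ι ∧ ι.range.Normal ∧ ι.range.index = 23 ∧
          ∀ s : 𝓞 K, γ₀ * ι (ofAdd s) * γ₀⁻¹ = ι (ofAdd (hζ.toInteger * s)))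
    (hψ : ∀ y : ComplexPoints ((baseChangeHom ψ).obj V),
      ∃ (ι' : Multiplicative
          ↥((Ideal.span {(2 : 𝓞 ℚ⟮ω⟯), w}).map (algebraMap (𝓞 ℚ⟮ω⟯) (𝓞 K))) →*
            FundamentalGroup _ y) (γ₀' : FundamentalGroup _ y),
        Function.Injective ι' ∧ ι'.range.Normal ∧ ι'.range.index = 23 ∧
          ∀ b : ↥((Ideal.span {(2 : 𝓞 ℚ⟮ω⟯), w}).map (algebraMap (𝓞 ℚ⟮ω⟯) (𝓞 K))),
            γ₀' * ι' (ofAdd b) * γ₀'⁻¹ = ι' (ofAdd (hζ.toInteger • b))) :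
    Serre1964_conjugateVarieties_notHomeomorphic := by
  refine serre1964_of_numberField_fundamentalGroup_form hV φ ψ fun x y ↦ ?_
  obtain ⟨ι, γ₀, hι, hN, hιi, hγ₀⟩ := hφ x
  obtain ⟨ι', γ₀', hι', hN', hι'i, hγ₀'⟩ := hψ y
  exact isEmpty_mulEquiv_twentyThree hζ hω w hw ι hι hιi γ₀ hγ₀ ι' hι' hι'i γ₀' hγ₀'

/-- The data of `isEmpty_mulEquiv_twentyThree` / `serre1964_of_fundamentalGroup_models` exist in
any field containing a primitive 23rd root of unity: a root `ω` of `X² - X + 6` (Gauss sum) and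
the algebraic integer `w = ω ∈ 𝓞 ℚ(ω)`. [folklore] -/
theorem exists_models_data {K : Type*} [Field K] [NumberField K] {ζ : K}
    (hζ : IsPrimitiveRoot ζ 23) :
    ∃ ω : K, ω ^ 2 = ω - 6 ∧ ∃ w : 𝓞 ℚ⟮ω⟯, (w : ℚ⟮ω⟯) = AdjoinSimple.gen ℚ ω := by
  obtain ⟨ω, hω⟩ := exists_sq_eq_self_sub_six hζ
  exact ⟨ω, hω, exists_ringOfIntegers_coe_eq_gen hω⟩

end Barrier

/-! ### Lemme 1: `S = ℤ[ζ_p]` is a free `D`-module of rank `(p - 1)/2` -/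

section LemmeOne

/-- **Relative monogenicity gives a relative power basis.** If the ring of integers of a number
field `K` is monogenic over `ℤ`, `𝓞 K = ℤ[α]`, then for every subfield `k ⊆ K` it is free over
`𝓞 k` with basis `1, α, …, α^{[K:k]-1}`: indeed `𝓞 K = ℤ[α] ⊆ (𝓞 k)[α] ⊆ 𝓞 K`, and the minimal
polynomial of `α` over the integrally closed `𝓞 k` is that over `k`, of degree
`[K : k] = [k(α) : k]`. [folklore] -/
theorem exists_powerBasis_ringOfIntegers_of_adjoin_eq_top {k K : Type*} [Field k] [NumberField k]
    [Field K] [NumberField K] [Algebra k K] (α : 𝓞 K) (hα : Algebra.adjoin ℤ {α} = ⊤)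
    (hαk : k⟮(α : K)⟯ = ⊤) :
    ∃ pb : PowerBasis (𝓞 k) (𝓞 K), pb.gen = α ∧ pb.dim = Module.finrank k K := by
  have hint : IsIntegral (𝓞 k) α := Algebra.IsIntegral.isIntegral α
  have htop : Algebra.adjoin (𝓞 k) {α} = ⊤ := by
    refine eq_top_iff.2 fun x _ ↦ ?_
    have hx : x ∈ Algebra.adjoin ℤ {α} := hα ▸ Algebra.mem_top
    have hle : Algebra.adjoin ℤ {α} ≤ (Algebra.adjoin (𝓞 k) {α}).restrictScalars ℤ :=
      Algebra.adjoin_le Algebra.subset_adjoin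
    exact hle hx
  refine ⟨PowerBasis.ofAdjoinEqTop' hint htop, PowerBasis.ofAdjoinEqTop'_gen hint htop, ?_⟩
  rw [PowerBasis.ofAdjoinEqTop'_dim]
  have h1 : minpoly k (algebraMap (𝓞 K) K α) = (minpoly (𝓞 k) α).map (algebraMap (𝓞 k) k) :=
    minpoly.isIntegrallyClosed_eq_field_fractions k K hint
  have h2 : (minpoly (𝓞 k) α).natDegree = (minpoly k (α : K)).natDegree := by
    rw [RingOfIntegers.coe_eq_algebraMap, h1,
      natDegree_map_eq_of_injective (RingOfIntegers.coe_injective) _]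
  have hintk : IsIntegral k (α : K) := Algebra.IsIntegral.isIntegral _
  rw [h2, ← adjoin.finrank hintk, hαk, IntermediateField.finrank_top']

/-- **Serre 1964, Lemme 1** ("Le `D`-module `S` est libre de rang `(p - 1)/2`"), in the
strong form "`1, ζ, …, ζ^{[K:k]-1}` is a basis": for `K ⊇ ℚ(ζ_n)` cyclotomic and ANY subfield
`k ⊆ K`, `S = 𝓞 K = ℤ[ζ_n]` has a power basis over `D = 𝓞 k` generated by `ζ_n`, of rank
`[K : k]`.  DESIGN NOTE: Serre derives freeness from the Steinitz class (`s²` = class of the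
discriminant, which is principal, and `h` odd); here it follows from `𝓞 K = ℤ[ζ]`
(Mathlib `IsCyclotomicExtension.Rat.adjoin_singleton_eq_top`) by
`exists_powerBasis_ringOfIntegers_of_adjoin_eq_top`, with no hypothesis on `h`.
[cite: Serre1964Conjugate, no. 1, Lemme 1] -/
theorem exists_powerBasis_ringOfIntegers_cyclotomic {n : ℕ} [NeZero n] {K : Type*} [Field K]
    [NumberField K] [IsCyclotomicExtension {n} ℚ K] {ζ : K} (hζ : IsPrimitiveRoot ζ n)
    (k : Type*) [Field k] [NumberField k] [Algebra k K] :
    ∃ pb : PowerBasis (𝓞 k) (𝓞 K), pb.gen = hζ.toInteger ∧ pb.dim = Module.finrank k K := by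
  refine exists_powerBasis_ringOfIntegers_of_adjoin_eq_top hζ.toInteger
    (IsCyclotomicExtension.Rat.adjoin_singleton_eq_top hζ) ?_
  have hQ : ℚ⟮ζ⟯ = ⊤ :=
    adjoin_eq_top_of_algebra ℚ _ (IsCyclotomicExtension.adjoin_primitive_root_eq_top hζ)
  exact adjoin_eq_top_of_adjoin_eq_top ℚ hQ

/-- **Lemme 1 for `p = 23`: `S = ℤ[ζ₂₃]` is a free `D = 𝓞 ℚ(ω)`-module of rank `11 = (p-1)/2`,
with basis `1, ζ, …, ζ¹⁰`, hence "le lemme 1 permet de plonger `S` dans `M₁₁(D)`"** (the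
regular representation in this basis, Mathlib `Algebra.leftMulMatrix`) — the input of Serre's
no. 2 making `S`, hence `G = ℤ/23`, act on `A = E¹¹`. [cite: Serre1964Conjugate, no. 1, Lemme 1 and no. 2] -/
theorem lemmeOne_twentyThree {K : Type*} [Field K] [NumberField K]
    [IsCyclotomicExtension {23} ℚ K] {ζ : K} (hζ : IsPrimitiveRoot ζ 23)
    {ω : K} (hω : ω ^ 2 = ω - 6) :
    (∃ pb : PowerBasis (𝓞 ℚ⟮ω⟯) (𝓞 K), pb.gen = hζ.toInteger ∧ pb.dim = 11) ∧
      Module.Free (𝓞 ℚ⟮ω⟯) (𝓞 K) ∧ Module.finrank (𝓞 ℚ⟮ω⟯) (𝓞 K) = 11 ∧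
      ∃ ρ : 𝓞 K →ₐ[𝓞 ℚ⟮ω⟯] Matrix (Fin 11) (Fin 11) (𝓞 ℚ⟮ω⟯), Function.Injective ρ := by
  obtain ⟨pb, hgen, hdim⟩ := exists_powerBasis_ringOfIntegers_cyclotomic hζ ℚ⟮ω⟯
  rw [finrank_adjoin_cyclotomic hω] at hdim
  refine ⟨⟨pb, hgen, hdim⟩, .of_basis pb.basis, by rw [pb.finrank, hdim], ?_⟩
  exact ⟨Algebra.leftMulMatrix (pb.basis.reindex (finCongr hdim)),
    Algebra.leftMulMatrix_injective _⟩

end LemmeOne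

/-! ### Lemme 2, module part: `π₁(A_φ) = π₁(E_φ) ⊗_D S` in coordinates -/

section LemmeTwoModule

open Module Multiplicative

/-- **`𝔞 ⊗_R S ≅ 𝔞S` in a basis** (the module-theoretic content of "on a évidemment
`π₁(A_φ) = π₁(E_φ) ⊗_D S`", Serre 1964, no. 1, Lemme 2): for an `R`-basis `b` of `S` and an
ideal `𝔞 ⊆ R`, the map `(aᵢ) ↦ ∑ aᵢ bᵢ` is an additive isomorphism `𝔞^ι ≃ 𝔞S` carrying the
action of `s ∈ S` through its regular-representation matrix `ρ_b(s)` (`Algebra.leftMulMatrix`,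
`s bⱼ = ∑ᵢ ρ(s)ᵢⱼ bᵢ`) to multiplication by `s`: `Φ(ρ(s)·a) = s·Φ(a)`.  With `R = D`, `S = ℤ[ζ_p]`,
`b` the basis of Lemme 1, `𝔞 = π₁(E_φ)`: the lattice `π₁(A_φ) = π₁(E_φ)^{(p-1)/2}` of `A = E^{(p-1)/2}`,
on which `S` acts through `S ↪ M(D)`, is the `S`-module `𝔞S`. [cite: Serre1964Conjugate, no. 1, Lemme 2] -/
theorem exists_addEquiv_pi_ideal_map {R S : Type*} [CommRing R] [CommRing S] [Algebra R S]
    {ι : Type*} [Fintype ι] [DecidableEq ι] (b : Basis ι R S) (𝔞 : Ideal R) :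
    ∃ Φ : (ι → ↥𝔞) ≃+ ↥(𝔞.map (algebraMap R S)),
      (∀ a, (Φ a : S) = ∑ i, (a i : R) • b i) ∧
      ∀ (s : S) (a : ι → ↥𝔞),
        (Φ (fun i ↦ ∑ j, Algebra.leftMulMatrix b s i j • a j) : S) = s * Φ a := by
  let φ : (ι → ↥𝔞) →+ S :=
    { toFun := fun a ↦ ∑ i, (a i : R) • b i
      map_zero' := by simp
      map_add' := fun a a' ↦ by
        simp only [Pi.add_apply, Submodule.coe_add, add_smul, Finset.sum_add_distrib] }
  have hφ : ∀ a, φ a = ∑ i, (a i : R) • b i := fun a ↦ rfl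
  have hmul : ∀ (s : S) (a : ι → ↥𝔞),
      φ (fun i ↦ ∑ j, Algebra.leftMulMatrix b s i j • a j) = s * φ a := by
    intro s a
    have hsb : ∀ j, s * b j = ∑ i, Algebra.leftMulMatrix b s i j • b i := fun j ↦ by
      conv_lhs => rw [← b.sum_repr (s * b j)]
      simp_rw [Algebra.leftMulMatrix_eq_repr_mul]
    rw [hφ, hφ, Finset.mul_sum]
    simp_rw [mul_smul_comm, hsb, Finset.smul_sum, smul_smul, Submodule.coe_sum, Submodule.coe_smul,
      smul_eq_mul, Finset.sum_smul]
    rw [Finset.sum_comm]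
    refine Finset.sum_congr rfl fun i _ ↦ Finset.sum_congr rfl fun j _ ↦ ?_
    rw [mul_comm]
  have hinj : Function.Injective φ := by
    intro a a' h
    have h' := congrArg (fun v ↦ ⇑(b.repr v)) h
    simp only [hφ, b.repr_sum_self] at h'
    funext i
    exact Subtype.ext (congrFun h' i)
  have hmem : ∀ a, φ a ∈ 𝔞.map (algebraMap R S) := fun a ↦ by
    rw [hφ]
    exact sum_mem fun i _ ↦ by
      rw [Algebra.smul_def]
      exact Ideal.mul_mem_right _ _ (Ideal.mem_map_of_mem _ (a i).2)
  have hsurj : ∀ y ∈ 𝔞.map (algebraMap R S), ∃ a, φ a = y := by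
    intro y hy
    refine Submodule.span_induction (p := fun y _ ↦ ∃ a, φ a = y) ?_ ?_ ?_ ?_ hy
    · rintro _ ⟨x, hx, rfl⟩
      refine ⟨fun i ↦ ⟨b.repr 1 i * x, 𝔞.mul_mem_left _ hx⟩, ?_⟩
      rw [hφ]
      calc ∑ i, (b.repr 1 i * x) • b i = x • ∑ i, b.repr 1 i • b i := by
            rw [Finset.smul_sum]
            exact Finset.sum_congr rfl fun i _ ↦ by rw [mul_comm, mul_smul]
        _ = algebraMap R S x := by rw [b.sum_repr, Algebra.algebraMap_eq_smul_one]
    · exact ⟨0, map_zero φ⟩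
    · rintro x y - - ⟨a, rfl⟩ ⟨a', rfl⟩
      exact ⟨a + a', map_add φ a a'⟩
    · rintro s y - ⟨a, rfl⟩
      exact ⟨_, hmul s a⟩
  let Φ₀ : (ι → ↥𝔞) →+ ↥(𝔞.map (algebraMap R S)) :=
    { toFun := fun a ↦ ⟨φ a, hmem a⟩
      map_zero' := Subtype.ext (map_zero φ)
      map_add' := fun a a' ↦ Subtype.ext (map_add φ a a') }
  have hbij : Function.Bijective Φ₀ := by
    refine ⟨fun a a' h ↦ hinj (congrArg Subtype.val h), fun y ↦ ?_⟩
    obtain ⟨a, ha⟩ := hsurj y.1 y.2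
    exact ⟨a, Subtype.ext ha⟩
  exact ⟨AddEquiv.ofBijective Φ₀ hbij, fun a ↦ rfl, fun s a ↦ hmul s a⟩

/-- **Serre's Théorème for `p = 23`, lattice form.** Same as `isEmpty_mulEquiv_twentyThree`, but
with the second distinguished subgroup presented as Serre's no. 2 presents it: `N' ≅ 𝔭¹¹`
(`= π₁(E_ψ)¹¹ = π₁(A_ψ)`, `A = E¹¹`, `π₁(E_ψ) ≅ 𝔭` the non-free lattice) with the generator of
`G = ℤ/23` acting through the matrix `ρ_b(ζ₂₃) ∈ M₁₁(D)` of `ζ₂₃` in a `D`-basis `b` of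
`S = 𝓞 K` (Lemme 1, `lemmeOne_twentyThree`; "le lemme 1 permet de plonger `S` dans `M₁₁(D)`,
donc de faire opérer `G` sur `A`").  Reduced to `isEmpty_mulEquiv_twentyThree` by
`exists_addEquiv_pi_ideal_map`. [cite: Serre1964Conjugate, nos. 1–2, Lemme 2, Théorème p. 4196] -/
theorem isEmpty_mulEquiv_twentyThree_pi {K : Type*} [Field K] [NumberField K]
    [IsCyclotomicExtension {23} ℚ K] {ζ : K} (hζ : IsPrimitiveRoot ζ 23)
    {ω : K} (hω : ω ^ 2 = ω - 6) (w : 𝓞 ℚ⟮ω⟯) (hw : (w : ℚ⟮ω⟯) = AdjoinSimple.gen ℚ ω)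
    (b : Basis (Fin 11) (𝓞 ℚ⟮ω⟯) (𝓞 K))
    {Γ Γ' : Type*} [Group Γ] [Group Γ']
    (ι : Multiplicative (𝓞 K) →* Γ) (hι : Function.Injective ι) [ι.range.Normal]
    (hιi : ι.range.index = 23) (γ₀ : Γ)
    (hγ₀ : ∀ s : 𝓞 K, γ₀ * ι (ofAdd s) * γ₀⁻¹ = ι (ofAdd (hζ.toInteger * s)))
    (ι' : Multiplicative (Fin 11 → ↥(Ideal.span {(2 : 𝓞 ℚ⟮ω⟯), w})) →* Γ')
    (hι' : Function.Injective ι') [hN' : ι'.range.Normal] (hι'i : ι'.range.index = 23) (γ₀' : Γ')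
    (hγ₀' : ∀ a : Fin 11 → ↥(Ideal.span {(2 : 𝓞 ℚ⟮ω⟯), w}),
      γ₀' * ι' (ofAdd a) * γ₀'⁻¹ =
        ι' (ofAdd fun i ↦ ∑ j, Algebra.leftMulMatrix b hζ.toInteger i j • a j)) :
    IsEmpty (Γ ≃* Γ') := by
  obtain ⟨Φ, -, hΦ⟩ := exists_addEquiv_pi_ideal_map b (Ideal.span {(2 : 𝓞 ℚ⟮ω⟯), w})
  let e : Multiplicative ↥((Ideal.span {(2 : 𝓞 ℚ⟮ω⟯), w}).map (algebraMap _ (𝓞 K))) ≃*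
      Multiplicative (Fin 11 → ↥(Ideal.span {(2 : 𝓞 ℚ⟮ω⟯), w})) :=
    Φ.symm.toMultiplicative
  let ι'' := ι'.comp e.toMonoidHom
  have hι'' : Function.Injective ι'' := hι'.comp e.injective
  have hrange : ι''.range = ι'.range := by
    ext y
    constructor
    · rintro ⟨x, rfl⟩
      exact ⟨e x, rfl⟩
    · rintro ⟨x, rfl⟩
      exact ⟨e.symm x, by simp [ι'']⟩
  haveI : ι''.range.Normal := hrange ▸ hN'
  have hι''i : ι''.range.index = 23 := by rw [hrange, hι'i]
  refine isEmpty_mulEquiv_twentyThree hζ hω w hw ι hι hιi γ₀ hγ₀ ι'' hι'' hι''i γ₀' fun c ↦ ?_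
  have he : ∀ c, e (ofAdd c) = ofAdd (Φ.symm c) := fun c ↦ rfl
  show γ₀' * ι' (e (ofAdd c)) * γ₀'⁻¹ = ι' (e (ofAdd (hζ.toInteger • c)))
  rw [he, he, hγ₀']
  congr 2
  apply Φ.injective
  rw [Φ.apply_symm_apply]
  apply Subtype.ext
  rw [hΦ, Φ.apply_symm_apply]
  rfl

/-- **Serre's Théorème for `p = 23`, fully in lattice coordinates.** As
`isEmpty_mulEquiv_twentyThree_pi`, with ALSO the first distinguished subgroup in the form no. 2
delivers it: `N ≅ D¹¹` (`= π₁(E_φ)¹¹ = π₁(A_φ)`, `π₁(E_φ) ≅ D` the free lattice) with the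
generator of `G` acting through the matrix `ρ_b(ζ₂₃)` (`Matrix.mulVec`), for a `D`-basis `b` of
`S = 𝓞 K` (Lemme 1); the coordinate isomorphism `S ≅ D¹¹`, `s ↦ b.repr s`, carries
multiplication by `ζ₂₃` to `ρ_b(ζ₂₃)` (Mathlib `Algebra.leftMulMatrix_mulVec_repr`).
[cite: Serre1964Conjugate, nos. 1–2, Lemme 2, Théorème p. 4196] -/
theorem isEmpty_mulEquiv_twentyThree_lattice {K : Type*} [Field K] [NumberField K]
    [IsCyclotomicExtension {23} ℚ K] {ζ : K} (hζ : IsPrimitiveRoot ζ 23)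
    {ω : K} (hω : ω ^ 2 = ω - 6) (w : 𝓞 ℚ⟮ω⟯) (hw : (w : ℚ⟮ω⟯) = AdjoinSimple.gen ℚ ω)
    (b : Basis (Fin 11) (𝓞 ℚ⟮ω⟯) (𝓞 K))
    {Γ Γ' : Type*} [Group Γ] [Group Γ']
    (ι : Multiplicative (Fin 11 → 𝓞 ℚ⟮ω⟯) →* Γ) (hι : Function.Injective ι) [hN : ι.range.Normal]
    (hιi : ι.range.index = 23) (γ₀ : Γ)
    (hγ₀ : ∀ a : Fin 11 → 𝓞 ℚ⟮ω⟯,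
      γ₀ * ι (ofAdd a) * γ₀⁻¹ = ι (ofAdd ((Algebra.leftMulMatrix b hζ.toInteger).mulVec a)))
    (ι' : Multiplicative (Fin 11 → ↥(Ideal.span {(2 : 𝓞 ℚ⟮ω⟯), w})) →* Γ')
    (hι' : Function.Injective ι') [ι'.range.Normal] (hι'i : ι'.range.index = 23) (γ₀' : Γ')
    (hγ₀' : ∀ a : Fin 11 → ↥(Ideal.span {(2 : 𝓞 ℚ⟮ω⟯), w}),
      γ₀' * ι' (ofAdd a) * γ₀'⁻¹ =
        ι' (ofAdd fun i ↦ ∑ j, Algebra.leftMulMatrix b hζ.toInteger i j • a j)) :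
    IsEmpty (Γ ≃* Γ') := by
  let e : Multiplicative (𝓞 K) ≃* Multiplicative (Fin 11 → 𝓞 ℚ⟮ω⟯) :=
    b.equivFun.toAddEquiv.toMultiplicative
  let ι₁ := ι.comp e.toMonoidHom
  have hι₁ : Function.Injective ι₁ := hι.comp e.injective
  have hrange : ι₁.range = ι.range := by
    ext y
    constructor
    · rintro ⟨x, rfl⟩
      exact ⟨e x, rfl⟩
    · rintro ⟨x, rfl⟩
      exact ⟨e.symm x, by simp [ι₁]⟩
  haveI : ι₁.range.Normal := hrange ▸ hN
  have hι₁i : ι₁.range.index = 23 := by rw [hrange, hιi]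
  refine isEmpty_mulEquiv_twentyThree_pi hζ hω w hw b ι₁ hι₁ hι₁i γ₀ (fun s ↦ ?_) ι' hι' hι'i
    γ₀' hγ₀'
  have he : ∀ s : 𝓞 K, e (ofAdd s) = ofAdd ⇑(b.repr s) := fun s ↦ rfl
  show γ₀ * ι (e (ofAdd s)) * γ₀⁻¹ = ι (e (ofAdd (hζ.toInteger * s)))
  rw [he, he, hγ₀, Algebra.leftMulMatrix_mulVec_repr]

end LemmeTwoModule

end Literature.Barriers.HodgeConjecture.Serre1964
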